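import Mathlib
import HarnessLib
import HarnessLib.Audit
import Summits.AtomisticToContinuum.FouriersLaw.Theses.ParityLiouvilleSeed
import Literature.MathematicalPhysics.KineticTheory.InfiniteChainInvariantStates
import Literature.MathematicalPhysics.KineticTheory.InfiniteChainObservables

/-!
# `Lines/birth.lean` — birth skeleton (BC3) for crux `ZeroCurrentRigidity`
(stmt-AtomisticToContinuum-12073; route ParityLiouvilleSeed, rank 2; shared decl text with
LocalOhmBV.ZeroCurrentRigidity)

LINE (the route's own TWO-LAYER PLAN for this node, "ZeroCurrentRigidity ⇐ NoLocalIntegrals →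
TiltStability", made precise): a persistent mean energy current in a REGULAR space-time
invariant state of the infinite chain must be PROTECTED BY AN ODD LOCAL CONSERVATION LAW
(Mazur's mechanism read backwards: in every known current-carrying regular stationary state of a
chain — harmonic radiating states (Spohn–Lebowitz 1977), boosted Gibbs states of unpinned chains,
Toda solitonic ensembles — the current is carried by an `R`-odd local conserved density:
`p_0 (q_1 - q_{-1})`, `p_0`, the odd Toda charges), while the anharmonic pinned chain has NO local
conservation law besides energy (Levi–Yamilov symmetry approach; the Euler-operator census of
prover c5 on this item: odd nullity 0 in 117 anharmonic cases). Energy is `R`-EVEN, so an odd law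
would have to be a shift-coboundary, which protects nothing.

Two registered stubs (the only `sorry`s of the file) and the kernel-checked composition
`ZeroCurrentRigidity_of : stub₁ → stub₂ → ParityLiouvilleSeed.ZeroCurrentRigidity`:

* `stub_noLocalIntegrals` — VERBATIM the open support item `LocalOhmBV.NoLocalIntegrals`
  (stmt-AtomisticToContinuum-12074, difficulty L, grounded: Levi–Yamilov / Yamilov 2006): for
  `ω₂, lam, β > 0` every smooth local density whose Liouville derivative is a shift-difference is
  `c·e_0 + (h - h∘τ) + k`. The COMPUTABLE half (symmetry approach / Euler-operator census); it is
  where anharmonicity enters (false at `lam = β = 0`).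
* `stub_oddLawOfCurrent` — CURRENTS NEED ODD LOCAL CHARGES (new; universal in the parameters, no
  sign conditions): if some regular, shift- and time-invariant probability measure of
  `pinnedChain ω₂ lam β γ` integrates `j_0` to a non-zero value, then the chain admits an `R`-odd
  (`R : p ↦ -p`) smooth local conservation law that is NOT a smooth local shift-coboundary. The
  STRUCTURAL half: true non-vacuously for the harmonic member (witness `p_0(q_1 - q_{-1})`) and
  for unpinned chains (witness `p_0`), i.e. exactly where the crux fails — so it is not the crux
  in costume; for anharmonic pinned parameters it is the open heart of the line (a converse-Mazur
  / completeness statement: regular invariant states see only local charges).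

Composition (real proof, ~40 lines): by contradiction, stub 2 gives an odd law `f` that is not a
coboundary; stub 1 writes `f = c·e_0 + (h - h∘τ) + k`; since `e_0 ∘ R = e_0` and `τ ∘ R = R ∘ τ`,
oddness forces `f = g - g∘τ` with the smooth local `g = (h - h∘R)/2` — a coboundary after all.

Disproof / negatives honoured: `zeroCurrentRigidity_false_without_regularity`
(Theorems/ParityLiouvilleSeedLiouvilleForHeatRadiatingWave: the radiating plane wave of
`pinnedChain 1 4 1 γ` is shift- and time-invariant with all moments and `∫ j_0 > 0`, but NOT
regular) — the line uses `IsRegular` at `stub_oddLawOfCurrent` (its hypothesis; orbit measures of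
travelling waves are singular, and the stub claims nothing about them); harmonic calibration
(SpohnLebowitz1977, HarmonicChainBallisticFlux): stub 2 holds there WITH a witness, stub 1 fails
there, as it must. No `Disproof.lean` / `Negative/` lemma exists for this crux (crux ls: no
workfiles, 2026-08-17); the negatives index of the summit has no statement about local
conservation laws.
-/

noncomputable section

namespace Summit.AtomisticToContinuum.FouriersLaw.Cruxes.ZeroCurrentRigidity.Birth

open MeasureTheory
open Literature.MathematicalPhysics.KineticTheory.HeatConduction

/-! ## Registered stubs (the only `sorry`s of the line) -/

/-- **stub 1 · `stub_noLocalIntegrals` — NO LOCAL CONSERVATION LAW BESIDES ENERGY** (verbatim the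
statement of item stmt-AtomisticToContinuum-12074 `LocalOhmBV.NoLocalIntegrals`; size L). For
`ω₂, lam, β > 0`, every smooth local density `f = g ∘ boxRestrict R` (`g ∈ C^∞`) whose Liouville
derivative is a total shift-difference `𝒜f = ψ - ψ ∘ τ` (`ψ` smooth local) is of the form
`c·e_0 + (h - h∘τ) + k`, `e_0 = p_0²/2 + U(q_0) + V(q_1 - q_0)`, `h` smooth local, `c, k ∈ ℝ`.
Why plausibly true: symmetry approach to lattice equations `q̈_n = F(q_{n-1}, q_n, q_{n+1})`
(Levi–Yamilov 1997, Yamilov 2006): a conservation law of order ≥ 3 forces the first canonical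
integrability condition, which fails for `V''(r) = 1 + 3βr²`, `β > 0`; low orders by hand; the
exact polynomial census (prover c5, this item's evidence) finds odd nullity 0 / even nullity 1 in
117 anharmonic cases. False at `lam = β = 0` (quadratic charges). -/
theorem stub_noLocalIntegrals :
    ∀ ω₂ lam β γ : ℝ, 0 < ω₂ → 0 < lam → 0 < β → ∀ f : Literature.MathematicalPhysics.KineticTheory.HeatConduction.ChainConfig → ℝ, (∃ (R : ℕ) (g : (Fin (2 * R + 1) → ℝ × ℝ) → ℝ), ContDiff ℝ ((⊤ : ℕ∞) : WithTop ℕ∞) g ∧ f = g ∘ Literature.MathematicalPhysics.KineticTheory.HeatConduction.boxRestrict R) → (∃ ψ : Literature.MathematicalPhysics.KineticTheory.HeatConduction.ChainConfig → ℝ, (∃ (R : ℕ) (g : (Fin (2 * R + 1) → ℝ × ℝ) → ℝ), ContDiff ℝ ((⊤ : ℕ∞) : WithTop ℕ∞) g ∧ ψ = g ∘ Literature.MathematicalPhysics.KineticTheory.HeatConduction.boxRestrict R) ∧ ∀ σ, Literature.MathematicalPhysics.KineticTheory.HeatConduction.liouvilleZ (Literature.MathematicalPhysics.KineticTheory.HeatConduction.pinnedChain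 ω₂ lam β γ) f σ = ψ σ - ψ (Literature.MathematicalPhysics.KineticTheory.HeatConduction.shift σ)) → ∃ (c k : ℝ) (h : Literature.MathematicalPhysics.KineticTheory.HeatConduction.ChainConfig → ℝ), (∃ (R : ℕ) (g : (Fin (2 * R + 1) → ℝ × ℝ) → ℝ), ContDiff ℝ ((⊤ : ℕ∞) : WithTop ℕ∞) g ∧ h = g ∘ Literature.MathematicalPhysics.KineticTheory.HeatConduction.boxRestrict R) ∧ ∀ σ, f σ = c * ((σ 0).2 ^ 2 / 2 + (Literature.MathematicalPhysics.KineticTheory.HeatConduction.pinnedChain ω₂ lam β γ).U (σ 0).1 + (Literature.MathematicalPhysics.KineticTheory.HeatConduction.pinnedChain ω₂ lam β γ).V ((σ 1).1 - (σ 0).1)) + (h σ - h (Literature.MathematicalPhysics.KineticTheory.HeatConduction.shift σ)) + k := by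
  sorry

/-- **stub 2 · `stub_oddLawOfCurrent` — A PERSISTENT CURRENT NEEDS AN ODD LOCAL CHARGE** (new; the
structural half; universal in the parameters — no sign conditions). For any real `ω₂ lam β γ`: if a
probability measure `ν` on `(ℝ×ℝ)^ℤ` is shift-invariant, time-invariant for the infinite chain
`pinnedChain ω₂ lam β γ` (generator sense) and regular, integrates `j_0`, and `∫ j_0 dν ≠ 0`,
then there is a smooth local density `f` which is ODD under the momentum reversal
`R : (q, p) ↦ (q, -p)`, is a local conservation law (`𝒜f = ψ - ψ∘τ`, `ψ` smooth local), and is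
NOT a shift-coboundary `g - g∘τ` of a smooth local `g`. Why plausibly true: every known
current-carrying regular stationary state of an oscillator chain is carried by an odd local
charge — harmonic radiating states (`f = p_0(q_1 - q_{-1})`, a witness making the stub TRUE at
`lam = β = 0`), boosted states of unpinned chains (`f = p_0`, `ω₂ = lam = 0`), Toda; conversely
Mazur's inequality is the only known mechanism for ballistic currents, and regularity (finite
entropy density) excludes the singular KAM/breather/travelling-wave invariant states. Why it might
fail: a regular invariant state protected by a QUASI-local (not strictly local) odd charge, or by
no charge at all (non-integrable resonance). Size: open (the heart of the line for anharmonic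
pinned parameters); M for the harmonic and unpinned special cases. -/
theorem stub_oddLawOfCurrent :
    ∀ ω₂ lam β γ : ℝ, ∀ ν : MeasureTheory.Measure Literature.MathematicalPhysics.KineticTheory.HeatConduction.ChainConfig, MeasureTheory.IsProbabilityMeasure ν → Literature.MathematicalPhysics.KineticTheory.HeatConduction.IsShiftInvariant ν → Literature.MathematicalPhysics.KineticTheory.HeatConduction.IsTimeInvariant (Literature.MathematicalPhysics.KineticTheory.HeatConduction.pinnedChain ω₂ lam β γ) ν → Literature.MathematicalPhysics.KineticTheory.HeatConduction.IsRegular (Literature.MathematicalPhysics.KineticTheory.HeatConduction.pinnedChain ω₂ lam β γ) ν → MeasureTheory.Integrable (fun σ => (Literature.MathematicalPhysics.KineticTheory.HeatConduction.pinnedChain ω₂ lam β γ).bondCurrentZ σ 0) ν → ∫ σ, (Literature.MathematicalPhysics.KineticTheory.HeatConduction.pinnedChain ω₂ lam β γ).bondCurrentZ σ 0 ∂ν ≠ 0 → ∃ f : Literature.MathematicalPhysics.KineticTheory.HeatConduction.ChainConfig → ℝ, (∃ (R : ℕ) (g : (Fin (2 * R + 1) → ℝ × ℝ) → ℝ), ContDiff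 ℝ ((⊤ : ℕ∞) : WithTop ℕ∞) g ∧ f = g ∘ Literature.MathematicalPhysics.KineticTheory.HeatConduction.boxRestrict R) ∧ (∀ σ : Literature.MathematicalPhysics.KineticTheory.HeatConduction.ChainConfig, f (fun x => ((σ x).1, -(σ x).2)) = -f σ) ∧ (∃ ψ : Literature.MathematicalPhysics.KineticTheory.HeatConduction.ChainConfig → ℝ, (∃ (R : ℕ) (g : (Fin (2 * R + 1) → ℝ × ℝ) → ℝ), ContDiff ℝ ((⊤ : ℕ∞) : WithTop ℕ∞) g ∧ ψ = g ∘ Literature.MathematicalPhysics.KineticTheory.HeatConduction.boxRestrict R) ∧ ∀ σ, Literature.MathematicalPhysics.KineticTheory.HeatConduction.liouvilleZ (Literature.MathematicalPhysics.KineticTheory.HeatConduction.pinnedChain ω₂ lam β γ) f σ = ψ σ - ψ (Literature.MathematicalPhysics.KineticTheory.HeatConduction.shift σ)) ∧ ¬ ∃ h : Literature.MathematicalPhysics.KineticTheory.HeatConduction.ChainConfig → ℝ, (∃ (R : ℕ) (g : (Fin (2 * R + 1) → ℝ × ℝ) → ℝ), ContDiff ℝ ((⊤ : ℕ∞) : WithTop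 ℕ∞) g ∧ h = g ∘ Literature.MathematicalPhysics.KineticTheory.HeatConduction.boxRestrict R) ∧ ∀ σ, f σ = h σ - h (Literature.MathematicalPhysics.KineticTheory.HeatConduction.shift σ) := by
  sorry

/-! ## Name-keyed aliases of the two statements (the hypothesis types of the composition)

`Registered.stub_*` is VERBATIM the statement of the theorem `stub_*` above (the wiring `example`
at the end certifies it definitionally); the composition takes the stubs as hypotheses BY NAME. -/

namespace Registered

/-- Verbatim statement of `stub_noLocalIntegrals`. -/
def stub_noLocalIntegrals : Prop :=
  ∀ ω₂ lam β γ : ℝ, 0 < ω₂ → 0 < lam → 0 < β → ∀ f : Literature.MathematicalPhysics.KineticTheory.HeatConduction.ChainConfig → ℝ, (∃ (R : ℕ) (g : (Fin (2 * R + 1) → ℝ × ℝ) → ℝ), ContDiff ℝ ((⊤ : ℕ∞) : WithTop ℕ∞) g ∧ f = g ∘ Literature.MathematicalPhysics.KineticTheory.HeatConduction.boxRestrict R) → (∃ ψ : Literature.MathematicalPhysics.KineticTheory.HeatConduction.ChainConfig → ℝ, (∃ (R : ℕ) (g : (Fin (2 * R + 1) → ℝ × ℝ) → ℝ), ContDiff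 ℝ ((⊤ : ℕ∞) : WithTop ℕ∞) g ∧ ψ = g ∘ Literature.MathematicalPhysics.KineticTheory.HeatConduction.boxRestrict R) ∧ ∀ σ, Literature.MathematicalPhysics.KineticTheory.HeatConduction.liouvilleZ (Literature.MathematicalPhysics.KineticTheory.HeatConduction.pinnedChain ω₂ lam β γ) f σ = ψ σ - ψ (Literature.MathematicalPhysics.KineticTheory.HeatConduction.shift σ)) → ∃ (c k : ℝ) (h : Literature.MathematicalPhysics.KineticTheory.HeatConduction.ChainConfig → ℝ), (∃ (R : ℕ) (g : (Fin (2 * R + 1) → ℝ × ℝ) → ℝ), ContDiff ℝ ((⊤ : ℕ∞) : WithTop ℕ∞) g ∧ h = g ∘ Literature.MathematicalPhysics.KineticTheory.HeatConduction.boxRestrict R) ∧ ∀ σ, f σ = c * ((σ 0).2 ^ 2 / 2 + (Literature.MathematicalPhysics.KineticTheory.HeatConduction.pinnedChain ω₂ lam β γ).U (σ 0).1 + (Literature.MathematicalPhysics.KineticTheory.HeatConduction.pinnedChain ω₂ lam β γ).V ((σ 1).1 - (σ 0).1)) + (h σ - h (Literature.MathematicalPhysics.KineticTheory.HeatConduction.shift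 σ)) + k

/-- Verbatim statement of `stub_oddLawOfCurrent`. -/
def stub_oddLawOfCurrent : Prop :=
  ∀ ω₂ lam β γ : ℝ, ∀ ν : MeasureTheory.Measure Literature.MathematicalPhysics.KineticTheory.HeatConduction.ChainConfig, MeasureTheory.IsProbabilityMeasure ν → Literature.MathematicalPhysics.KineticTheory.HeatConduction.IsShiftInvariant ν → Literature.MathematicalPhysics.KineticTheory.HeatConduction.IsTimeInvariant (Literature.MathematicalPhysics.KineticTheory.HeatConduction.pinnedChain ω₂ lam β γ) ν → Literature.MathematicalPhysics.KineticTheory.HeatConduction.IsRegular (Literature.MathematicalPhysics.KineticTheory.HeatConduction.pinnedChain ω₂ lam β γ) ν → MeasureTheory.Integrable (fun σ => (Literature.MathematicalPhysics.KineticTheory.HeatConduction.pinnedChain ω₂ lam β γ).bondCurrentZ σ 0) ν → ∫ σ, (Literature.MathematicalPhysics.KineticTheory.HeatConduction.pinnedChain ω₂ lam β γ).bondCurrentZ σ 0 ∂ν ≠ 0 → ∃ f : Literature.MathematicalPhysics.KineticTheory.HeatConduction.ChainConfig → ℝ, (∃ (R : ℕ) (g : (Fin (2 * R + 1) → ℝ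 × ℝ) → ℝ), ContDiff ℝ ((⊤ : ℕ∞) : WithTop ℕ∞) g ∧ f = g ∘ Literature.MathematicalPhysics.KineticTheory.HeatConduction.boxRestrict R) ∧ (∀ σ : Literature.MathematicalPhysics.KineticTheory.HeatConduction.ChainConfig, f (fun x => ((σ x).1, -(σ x).2)) = -f σ) ∧ (∃ ψ : Literature.MathematicalPhysics.KineticTheory.HeatConduction.ChainConfig → ℝ, (∃ (R : ℕ) (g : (Fin (2 * R + 1) → ℝ × ℝ) → ℝ), ContDiff ℝ ((⊤ : ℕ∞) : WithTop ℕ∞) g ∧ ψ = g ∘ Literature.MathematicalPhysics.KineticTheory.HeatConduction.boxRestrict R) ∧ ∀ σ, Literature.MathematicalPhysics.KineticTheory.HeatConduction.liouvilleZ (Literature.MathematicalPhysics.KineticTheory.HeatConduction.pinnedChain ω₂ lam β γ) f σ = ψ σ - ψ (Literature.MathematicalPhysics.KineticTheory.HeatConduction.shift σ)) ∧ ¬ ∃ h : Literature.MathematicalPhysics.KineticTheory.HeatConduction.ChainConfig → ℝ, (∃ (R : ℕ) (g : (Fin (2 * R + 1) → ℝ × ℝ) → ℝ), ContDiff ℝ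 ((⊤ : ℕ∞) : WithTop ℕ∞) g ∧ h = g ∘ Literature.MathematicalPhysics.KineticTheory.HeatConduction.boxRestrict R) ∧ ∀ σ, f σ = h σ - h (Literature.MathematicalPhysics.KineticTheory.HeatConduction.shift σ)

end Registered

/-! ## The composition: the two stubs give the crux BY NAME (no `sorry` below) -/

/-- **`ZeroCurrentRigidity` from the two stubs.** By contradiction: a regular space-time invariant
state with `∫ j_0 dν ≠ 0` yields (stub 2) an `R`-odd smooth local conservation law `f` that is not
a coboundary; the census (stub 1) writes `f = c·e_0 + (h - h∘τ) + k`; `e_0` is `R`-even and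
`τ (Rσ) = R (τσ)`, so `f = ½(f - f∘R) = g - g∘τ` with `g = ½(h - h∘R)`, which is smooth local
(`h∘R = (G ∘ R_box) ∘ boxRestrict R₀` for the linear box reversal `R_box`) — a coboundary after
all. -/
theorem ZeroCurrentRigidity_of (h1 : Registered.stub_noLocalIntegrals)
    (h2 : Registered.stub_oddLawOfCurrent) :
    Summit.AtomisticToContinuum.FouriersLaw.Theses.ParityLiouvilleSeed.ZeroCurrentRigidity := by
  intro ω₂ lam β γ hω hl hβ ν hprob hshift htime hreg hint
  by_contra hJ
  obtain ⟨f, hfloc, hodd, hcons, hnot⟩ := h2 ω₂ lam β γ ν hprob hshift htime hreg hint hJ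
  obtain ⟨c, k, h, ⟨R, G, hG, hhG⟩, hform⟩ := h1 ω₂ lam β γ hω hl hβ f hfloc hcons
  apply hnot
  -- the (linear) momentum reversal of the centred box `{-R, …, R}`
  let L : (Fin (2 * R + 1) → ℝ × ℝ) →L[ℝ] (Fin (2 * R + 1) → ℝ × ℝ) :=
    ContinuousLinearMap.pi fun i =>
      ((ContinuousLinearMap.fst ℝ ℝ ℝ).comp (ContinuousLinearMap.proj i)).prod
        (-((ContinuousLinearMap.snd ℝ ℝ ℝ).comp (ContinuousLinearMap.proj i)))
  have hL : ∀ (y : Fin (2 * R + 1) → ℝ × ℝ) (i : Fin (2 * R + 1)), L y i = ((y i).1, -(y i).2) := by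
    intro y i
    simp [L]
  have hbox : ∀ σ : ChainConfig,
      boxRestrict R (fun x => ((σ x).1, -(σ x).2)) = L (boxRestrict R σ) := by
    intro σ
    funext i
    rw [hL]
    rfl
  have hh : ∀ σ : ChainConfig, h σ = G (boxRestrict R σ) := by
    intro σ
    rw [hhG]
    rfl
  have hhR : ∀ σ : ChainConfig, h (fun x => ((σ x).1, -(σ x).2)) = G (L (boxRestrict R σ)) := by
    intro σ
    rw [hh, hbox]
  refine ⟨fun σ => (h σ - h (fun x => ((σ x).1, -(σ x).2))) / 2,
    ⟨R, fun y => (G y - G (L y)) / 2, ?_, ?_⟩, ?_⟩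
  · exact (hG.sub (hG.comp L.contDiff)).div_const 2
  · funext σ
    simp only [Function.comp_apply]
    rw [hhR σ, hh σ]
  · intro σ
    -- the census at `σ` and at `Rσ`, and oddness of `f`
    have e1 := hform σ
    have e2 := hform (fun x => ((σ x).1, -(σ x).2))
    have e3 := hodd σ
    have hs : shift (fun x => ((σ x).1, -(σ x).2)) =
        fun x => (((shift σ) x).1, -((shift σ) x).2) := by
      funext x
      rfl
    have hE : ((fun x : ℤ => ((σ x).1, -(σ x).2)) 0).2 ^ 2 / 2 +
          (pinnedChain ω₂ lam β γ).U ((fun x : ℤ => ((σ x).1, -(σ x).2)) 0).1 +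
          (pinnedChain ω₂ lam β γ).V (((fun x : ℤ => ((σ x).1, -(σ x).2)) 1).1 -
            ((fun x : ℤ => ((σ x).1, -(σ x).2)) 0).1) =
        (σ 0).2 ^ 2 / 2 + (pinnedChain ω₂ lam β γ).U (σ 0).1 +
          (pinnedChain ω₂ lam β γ).V ((σ 1).1 - (σ 0).1) := by
      simp only [neg_sq]
    rw [hs, hE] at e2
    simp only
    linarith

/-- Wiring check: the two registered stubs feed `ZeroCurrentRigidity_of` exactly as stated (their
verbatim statements are definitionally the `Registered.*` aliases). An `example`, so that
`ZeroCurrentRigidity_of` stays the only theorem of the file concluding the crux. -/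
example : Summit.AtomisticToContinuum.FouriersLaw.Theses.ParityLiouvilleSeed.ZeroCurrentRigidity :=
  ZeroCurrentRigidity_of stub_noLocalIntegrals stub_oddLawOfCurrent

end Summit.AtomisticToContinuum.FouriersLaw.Cruxes.ZeroCurrentRigidity.Birth

end
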